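import Summits.ValiantsHypothesis.ValiantsHypothesis.Theorems.NewtonUnitEquationsTwoProductsRankOneOneSidedLawSlice
import HarnessLib

/-!
# Route NewtonUnitEquations — crux `TwoProducts` (stmt-ValiantsHypothesis-5906), line `relation_ladder`, rung R8 (ONE-SIDED rank one
# `p•α = Σ_i q_i•β_i`, any number of plus letters): the DILATED FREE LIFT with a plus-letter SET — part 3/6 — the exceptional point of a slice, support characterisation, `xOf`, `Fsl_congr` (T4 end)

Part 3: `x̂ = 0` (`coeff_free_logTrunc_exc`, `Fsl_exc`), `mem_support_free_logTrunc_iff`, `shape_of_Fsl_ne_zero`, `Fsl_zero_zero`, the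
section `xOf b ν` of `x ↦ (x|B, x̂)` and `Fsl_congr` (the slice function reads `b` only on the plus letters).

THE ONE-SIDED RANK-ONE LAW `p•α = Σ_{i<k} q_i•β_i` (R8; all `p, q_i ≥ 1`, distinct letters, every additive coincidence of the letter
family a multiple of this one relation): GLOBALLY `#visible ≤ 2^{c m}(#T + 2)^c` (`c = 1732`).  Engine (val-idea-8 g3's memo
`Cruxes/TwoProducts/Lines/relation_ladder_R8_engine.md` rev 2, typed target `Lines/relation_ladder_sketch_R8.lean :: R8.RankOneOneSidedLaw`,
slice count `Lines/relation_ladder_R8_simplex.lean` = landed `…RankOneSimplexCount`): the DILATED FREE LIFT `α ↦ ∏ Y_j^{q_j}`, `Y_j ↦ Y_j^p` on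
the plus letters, identity elsewhere, over the `p`-dilated plane (`enumP : j ↦ enum j` on the plus letters, `i ↦ p•enum i` otherwise); fibres
`k = #α` with divisibility guards `p ∣ x_j − q_j k`; letter count `B_k = k + Σ_j (x_j − q_j k)/p`; SLICING by the whole plus-letter exponent
vector `b = x|_B`; the coefficient theorem with `Pfac · C(R + B_k − 1, B_k) · κ_k`; finite SHIFT RANK `2m(Σb + 1)² + 1` and val-lit-p3's
`ShiftRank.pencilCount` BY NAME; the slices of the visible points factor through the restricted letter multisets `L₀|_{a ∪ B}` (`deg L₀ ≤ m`),
counted by the simplex bound `#W ≤ 2^{n+k}` (`R8.card_W_le`); WIDE plus sides (`k > m + 1`), large (`> m`) or absent coefficients/letters are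
permutation type (R3♯).  `k = 1` is R7c (`R7b.rankOneTwoLaw_proof`), `k = 2` is R7b (`R7b.rankOneThreeGenLaw_proof`).

AUTHORSHIP / LANE NOTE (val-lit-p3 g15, prover seat, helper mode `--supports stmt-ValiantsHypothesis-5906 --as helper`; CLAIM-FIRST #2 on the
val-lit bus 12:55Z, silence = GO 13:30Z, no objection; the line owner val-idea-8 g3 CLOSED 12:24Z leaving R8 as a typed target + memo): part 3/6.
The STATEMENT is val-idea-8 g3's typed `R8.RankOneOneSidedLaw` (landed here by its LITERAL BODY, `OneSidedRankOne` unfolded — parameter-free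
`def … : Prop` are not declared in Theorems files); the engine follows g3's memo decl-by-decl as a generalisation of the landed R7b REV 2 port
(`…RankOneThreeGenLaw*`, namespace `R7b`); the Lean text of this module is this seat's.  Reused BY NAME: `R6b.HSD` (+ closure lemmas),
`R7b.dilE`/`R7b.piT_dilE`/`R7b.piE_dilE`, `R7a.permType_of_rankOne_largeCoeff/absent`, `toolBound_mono`, `tab`, `sgn`, `R6b.sum_sgn`,
`PlanarCell.eq_of_nsmul_eq`, `FormalLogLinearisation.wt_nsmul`, `R8.card_W_le` (simplex).  Namespace `…PermutationType.R8` (the typed target's).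
Nothing here closes the line's residual (`ResidualLawV20`), the crux `TwoProducts` (5906) or `VP ≠ VNP`; no summit statement is proved.

Honest scope: TWO-SIDED relations with ≥ 2 letters on each side (e.g. `α+2β = γ+δ`, val-neg-1 g4's p635912) and coincidence rank ≥ 2 are NOT
covered.  Nothing here moves VP ≠ VNP; `TwoProducts` (5906) / `PlanarCellBound` stay OPEN. [folklore]
-/

noncomputable section

-- Sub = Summit single-conjunct layout: the duplicated namespace component is mandated by the tree.
set_option linter.dupNamespace false
set_option linter.unusedSimpArgs false
set_option linter.unusedSectionVars false
set_option linter.unusedVariables false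

namespace Summit.ValiantsHypothesis.ValiantsHypothesis.Theorems.NewtonUnitEquations.TwoProducts.PermutationType
namespace R8
open scoped BigOperators
open MvPolynomial

variable {σ : Type*} [Fintype σ] [DecidableEq σ]

variable (Io : OIdx σ)

section Slice
variable {m : ℕ}

/-! ### The exceptional point of a slice (`R = 0`, i.e. `x` supported on the plus letters) -/

/-- At an exceptional exponent every coordinate off the plus letters vanishes. [folklore] -/
theorem exc_apply (x : σ →₀ ℕ) (hx : x Io.a = 0) (h0 : deg (xhat Io x) = 0) (j : σ) (hjq : Io.qf j = 0) :
    x j = 0 := by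
  have hz : xhat Io x = 0 := (deg_eq_zero_iff _).mp h0
  by_cases hja : j = Io.a
  · rw [hja, hx]
  · have := DFunLike.congr_fun hz j
    rwa [xhat_rest Io x ((mem_rest Io j).2 ⟨hja, hjq⟩)] at this

/-- At an exceptional exponent the reduced exponent is zero. [folklore] -/
theorem xhat_exc_apply (x : σ →₀ ℕ) (h0 : deg (xhat Io x) = 0) (j : σ) : xhat Io x j = 0 := by
  rw [(deg_eq_zero_iff _).mp h0]; rfl

/-- At an exceptional exponent the rest-product is `1`. [folklore] -/
theorem restProd_exc (t : σ → ℂ) (x : σ →₀ ℕ) (h0 : deg (xhat Io x) = 0) : restProd Io t ⇑(xhat Io x) = 1 := by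
  unfold restProd
  exact Finset.prod_eq_one fun j _ => by rw [xhat_exc_apply Io x h0 j, pow_zero]

/-- At an exceptional exponent the multinomial of the fibre element is `κ_k`. [folklore] -/
theorem multinomial_exc (x : σ →₀ ℕ) (hx : x Io.a = 0) (h0 : deg (xhat Io x) = 0) (k : ℕ) :
    ((Lof Io x k).multinomial : ℂ) = kap Io x k := by
  have hdeg := deg_Lof_eq Io x k
  rw [h0, zero_add] at hdeg
  have s := Nat.multinomial_spec (Finset.univ : Finset σ) (Lof Io x k)
  rw [← multinomial_univ, ← deg_eq_sum, prod_split Io, Lof_a, hdeg] at s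
  have hr : ∏ j ∈ rest Io, ((Lof Io x k) j).factorial = 1 := by
    refine Finset.prod_eq_one fun j hj => ?_
    rw [Lof_rest Io x k hj, exc_apply Io x hx h0 j ((mem_rest Io j).1 hj).2, Nat.factorial_zero]
  have hb : ∏ j ∈ B Io, ((Lof Io x k) j).factorial = ∏ j ∈ B Io, ((x j - Io.qf j * k) / Io.p).factorial :=
    Finset.prod_congr rfl fun j hj => by rw [Lof_B Io x k hj]
  rw [hr, hb, one_mul] at s
  have hKd : (((k.factorial * ∏ j ∈ B Io, ((x j - Io.qf j * k) / Io.p).factorial : ℕ)) : ℂ) ≠ 0 :=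
    Nat.cast_ne_zero.mpr (Nat.mul_ne_zero (Nat.factorial_ne_zero _)
      (Finset.prod_ne_zero_iff.mpr fun j _ => Nat.factorial_ne_zero _))
  unfold kap
  rw [eq_div_iff hKd]
  have e : (((k.factorial * (∏ j ∈ B Io, ((x j - Io.qf j * k) / Io.p).factorial) *
      (Lof Io x k).multinomial : ℕ)) : ℂ) = (((Bk Io x k).factorial : ℕ) : ℂ) := by exact_mod_cast s
  push_cast at e ⊢
  linear_combination e

/-- The signed atom sum of the constants of an admissible `k`. [folklore] -/
theorem sum_mainConst (c d : Fin m → σ → ℂ) (b : σ → ℕ) (k : ℕ) (hk : Adm Io b k) :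
    ∑ j, mainConst Io c d b j k = (-1 : ℂ) ^ (sB Io b + Bk Io b k) * kap Io b k *
      (∑ j : Fin m, c j Io.a ^ k * plusProd Io (c j) b k - ∑ j : Fin m, d j Io.a ^ k * plusProd Io (d j) b k) := by
  rw [Fintype.sum_sum_type]
  simp only [mainConst, gd_pos Io hk, tab, sgn, Sum.elim_inl, Sum.elim_inr]
  rw [mul_sub, Finset.mul_sum, Finset.mul_sum, sub_eq_add_neg, ← Finset.sum_neg_distrib]
  congr 1
  · exact Finset.sum_congr rfl fun j _ => by ring
  · exact Finset.sum_congr rfl fun j _ => by ring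

/-- The slice function at the exceptional point: only the correction survives. [folklore] -/
theorem Fsl_exc (c d : Fin m → σ → ℂ) (b : σ → ℕ) (hb : 1 ≤ sB Io b) (ν : σ → ℕ) (hν : ∀ j, ν j = 0) :
    R8.Fsl Io c d b ν = ∑ j : Fin m ⊕ Fin m, ∑ k : Fin (sB Io b + 1), R8.mainConst Io c d b j k / ((R8.Bk Io b k : ℕ) : ℂ) := by
  have hmain : ∑ j : Fin m ⊕ Fin m, ∑ k : Fin (sB Io b + 1), mainTerm Io c d b j k ν = 0 := by
    refine Finset.sum_eq_zero fun j _ => Finset.sum_eq_zero fun k _ => ?_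
    unfold mainTerm
    by_cases hk : Adm Io b k
    · have hlam : lam Io ν = 0 := by unfold lam; simp [hν]
      have hB := Bk_pos Io hk hb
      rw [hlam, Nat.choose_eq_zero_of_lt (by omega)]
      simp
    · rw [mainConst_eq_zero Io c d hk j, zero_mul]
  unfold Fsl
  rw [hmain, mul_zero, zero_add]
  unfold corr
  rw [if_pos hν]

/-- **THE COEFFICIENT THEOREM at an exceptional exponent** (`x̂ = 0`, `x ≠ 0` supported on the plus letters). [folklore] -/
theorem coeff_free_logTrunc_exc (c d : Fin m → σ → ℂ) (R : ℕ) (x : σ →₀ ℕ) (hx : x Io.a = 0)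
    (h0 : deg (xhat Io x) = 0) (hbc : 1 ≤ sB Io x) (hR : deg x ≤ R) :
    coeff x (phiT (frM Io) (logTrunc c d R)) =
      (-1 : ℂ) ^ (sB Io x + 1) * Fsl Io c d x ⇑(xhat Io x) := by
  classical
  rw [coeff_phiT_frM Io _ x hx]
  have hdx : deg x = sB Io x := by rw [deg_eq_deg_xhat_add Io x, hx, h0, zero_add, zero_add]; rfl
  have hz : ∀ j, (xhat Io x) j = 0 := xhat_exc_apply Io x h0
  rw [Fsl_exc Io c d x hbc _ hz, Finset.sum_comm, Finset.mul_sum]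
  rw [Fin.sum_univ_eq_sum_range (fun k => (-1 : ℂ) ^ (sB Io x + 1) *
    ∑ j : Fin m ⊕ Fin m, mainConst Io c d x j k / ((Bk Io x k : ℕ) : ℂ)) (sB Io x + 1)]
  unfold KR
  rw [← sB_coe, Finset.sum_filter]
  refine Finset.sum_congr rfl fun k _ => ?_
  by_cases hk : Adm Io x k
  · rw [if_pos hk]
    have hdeg := deg_Lof_eq Io x k
    rw [h0, zero_add] at hdeg
    have hB1 := Bk_pos Io hk hbc
    have hBle := Bk_le Io hk
    have hdeg1 : 1 ≤ deg (Lof Io x k) := by omega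
    have hdegR : deg (Lof Io x k) ≤ R := by
      have hdx' := hdx; unfold sB at hBle hdx'; omega
    rw [coeff_logTrunc c d R _ hdeg1 hdegR, multinomial_exc Io x hx h0 k, hdeg]
    have hsign : (-1 : ℂ) ^ (Bk Io x k + 1) =
        (-1) ^ (sB Io x + 1) * (-1) ^ (sB Io x + Bk Io x k) := by
      have e : sB Io x + 1 + (sB Io x + Bk Io x k) = (Bk Io x k + 1) + 2 * sB Io x := by omega
      rw [← pow_add, e, pow_add (-1 : ℂ) (Bk Io x k + 1), pow_mul]
      norm_num
    rw [hsign, ← Finset.sum_div, sum_mainConst Io c d _ k hk]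
    simp only [mom_Lof Io _ x k, restProd_exc Io _ x h0, mul_one]
    ring
  · rw [if_neg hk]
    rw [Finset.sum_eq_zero (fun j _ => by rw [mainConst_eq_zero Io c d hk j, zero_div]), mul_zero]

/-- **The support criterion**: `x ≠ 0` with `x_a = 0` and `deg x ≤ R` lies in the support of the lift of `Λ_R` iff `F_x(x̂) ≠ 0`.
[folklore] -/
theorem mem_support_free_logTrunc_iff (c d : Fin m → σ → ℂ) (R : ℕ) (x : σ →₀ ℕ) (hx : x Io.a = 0) (hne : x ≠ 0)
    (hR : deg x ≤ R) :
    x ∈ (phiT (frM Io) (logTrunc c d R)).support ↔ Fsl Io c d x ⇑(xhat Io x) ≠ 0 := by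
  rw [mem_support_iff]
  by_cases h1 : 1 ≤ deg (xhat Io x)
  · rw [coeff_free_logTrunc Io c d R x hx h1 hR]
    have hc : (-1 : ℂ) ^ (deg x + 1) * Pfac Io x ≠ 0 :=
      mul_ne_zero (pow_ne_zero _ (neg_ne_zero.mpr one_ne_zero)) (Pfac_ne_zero Io x)
    constructor
    · intro h hF; exact h (by rw [hF, mul_zero])
    · intro h; exact mul_ne_zero hc h
  · have h0 : deg (xhat Io x) = 0 := by omega
    have hbc : 1 ≤ sB Io x := by
      by_contra h
      apply hne
      have hall : ∀ j ∈ B Io, x j = 0 := fun j hj => by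
        have := Finset.single_le_sum (f := fun j => x j) (fun j _ => Nat.zero_le _) hj
        unfold sB at h; omega
      ext j
      by_cases hjB : j ∈ B Io
      · rw [hall j hjB]; rfl
      · have hjq : Io.qf j = 0 := by rw [mem_B] at hjB; push Not at hjB; exact hjB
        rw [exc_apply Io x hx h0 j hjq]; rfl
    rw [coeff_free_logTrunc_exc Io c d R x hx h0 hbc hR]
    have hc : (-1 : ℂ) ^ (sB Io x + 1) ≠ 0 := pow_ne_zero _ (neg_ne_zero.mpr one_ne_zero)
    constructor
    · intro h hF; exact h (by rw [hF, mul_zero])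
    · intro h; exact mul_ne_zero hc h

/-- Non-vanishing of a slice function forces `ν_a = 0` and `ν_j = 0` on the plus letters. [folklore] -/
theorem shape_of_Fsl_ne_zero (c d : Fin m → σ → ℂ) (b : σ → ℕ) (ν : σ → ℕ) (h : Fsl Io c d b ν ≠ 0) :
    ν Io.a = 0 ∧ ∀ j ∈ B Io, ν j = 0 := by
  by_contra hcon
  apply h
  unfold Fsl ind corr
  rw [if_neg hcon, zero_mul, zero_add, if_neg]
  intro hall
  exact hcon ⟨hall Io.a, fun j _ => hall j⟩

/-- The slice function of the zero slice vanishes at the origin (equal numbers of `±` atoms). [folklore] -/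
theorem Fsl_zero_zero (c d : Fin m → σ → ℂ) (b : σ → ℕ) (hb : sB Io b = 0) (ν : σ → ℕ) (hν : ∀ j, ν j = 0) :
    Fsl Io c d b ν = 0 := by
  have hbj : ∀ j ∈ B Io, b j = 0 := fun j hj => by
    have := Finset.single_le_sum (f := fun j => b j) (fun j _ => Nat.zero_le _) hj
    unfold sB at hb; omega
  have hB : Bk Io b 0 = 0 := by
    unfold Bk; rw [zero_add]; exact Finset.sum_eq_zero fun j hj => by rw [hbj j hj]; simp
  have hpp : ∀ t : σ → ℂ, plusProd Io t b 0 = 1 := fun t =>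
    Finset.prod_eq_one fun j hj => by rw [hbj j hj]; simp
  have hkap : kap Io b 0 = 1 := by
    unfold kap; rw [hB]
    have : ∏ j ∈ B Io, ((b j - Io.qf j * 0) / Io.p).factorial = 1 :=
      Finset.prod_eq_one fun j hj => by rw [hbj j hj]; simp
    rw [this]; simp
  have hgd : gd Io b 0 = 1 := by
    unfold gd; rw [if_pos (fun j hj => ⟨by simp, by rw [hbj j hj]; simp⟩)]
  have hmain : ∀ j : Fin m ⊕ Fin m, ∑ k : Fin (sB Io b + 1), mainTerm Io c d b j k ν = sgn m j := by
    intro j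
    rw [hb, Fin.sum_univ_one]
    show mainTerm Io c d b j 0 ν = sgn m j
    unfold mainTerm mainConst restProd
    rw [hgd, hkap, hB, hpp]
    simp [hν, sB, Finset.sum_eq_zero hbj]
  have hcorr : corr Io c d b ν = 0 := by
    unfold corr
    rw [if_pos hν, hb]
    have : ∀ j : Fin m ⊕ Fin m, ∑ k : Fin (0 + 1), mainConst Io c d b j k / ((Bk Io b k : ℕ) : ℂ) = 0 := by
      intro j
      rw [Fin.sum_univ_one]
      show mainConst Io c d b j 0 / ((Bk Io b 0 : ℕ) : ℂ) = 0
      rw [hB]; simp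
    simp only [this, Finset.sum_const_zero]
  unfold Fsl
  rw [hcorr, add_zero]
  simp only [hmain, R6b.sum_sgn, mul_zero]

/-- The exponent with prescribed slice vector `b` (on the plus letters) and reduced part `ν`. [folklore] -/
def xOf (b : σ → ℕ) (ν : σ → ℕ) : σ →₀ ℕ :=
  ofFun fun j => if j = Io.a then 0 else if Io.qf j ≠ 0 then b j else ν j

/-- `xOf` on the plus letters. [folklore] -/
theorem xOf_B (b ν : σ → ℕ) {j : σ} (hj : j ∈ B Io) : xOf Io b ν j = b j := by
  have hja := ne_a_of_mem_B Io hj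
  rw [mem_B] at hj; simp [xOf, hja, hj]

/-- `xOf` at the lone letter. [folklore] -/
theorem xOf_a (b ν : σ → ℕ) : xOf Io b ν Io.a = 0 := by
  simp [xOf]

/-- `xOf` on the rest. [folklore] -/
theorem xOf_rest (b ν : σ → ℕ) {j : σ} (hj : j ∈ rest Io) : xOf Io b ν j = ν j := by
  rw [mem_rest] at hj; simp [xOf, hj.1, hj.2]

/-- The reduced part of `xOf b ν` is `ν`. [folklore] -/
theorem xhat_xOf (b ν : σ → ℕ) (ha : ν Io.a = 0) (hB : ∀ j ∈ B Io, ν j = 0) : ⇑(xhat Io (xOf Io b ν)) = ν := by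
  funext j
  by_cases hja : j = Io.a
  · subst hja; rw [xhat_a, ha]
  by_cases hjB : j ∈ B Io
  · rw [xhat_B Io _ hjB, hB j hjB]
  · have hjr : j ∈ rest Io := (mem_rest Io j).2 ⟨hja, by rw [mem_B] at hjB; push Not at hjB; exact hjB⟩
    rw [xhat_rest Io _ hjr, xOf_rest Io b ν hjr]

/-- An exponent with `x_a = 0` is recovered from its slice vector and its reduced part. [folklore] -/
theorem xOf_xhat (x : σ →₀ ℕ) (hx : x Io.a = 0) : xOf Io x ⇑(xhat Io x) = x := by
  ext j
  by_cases hja : j = Io.a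
  · subst hja; rw [xOf_a, hx]
  by_cases hjB : j ∈ B Io
  · rw [xOf_B Io _ _ hjB]
  · have hjr : j ∈ rest Io := (mem_rest Io j).2 ⟨hja, by rw [mem_B] at hjB; push Not at hjB; exact hjB⟩
    rw [xOf_rest Io _ _ hjr, xhat_rest Io x hjr]

/-- The slice data agree on the plus letters ⇒ the slice functions agree (all slice objects read `b` only on `B`). [folklore] -/
theorem Fsl_congr (c d : Fin m → σ → ℂ) {b b' : σ → ℕ} (h : ∀ j ∈ B Io, b j = b' j) : Fsl Io c d b = Fsl Io c d b' := by
  have hs : sB Io b = sB Io b' := Finset.sum_congr rfl h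
  have hA : ∀ k, Adm Io b k ↔ Adm Io b' k := fun k => by
    unfold Adm
    exact ⟨fun H j hj => by rw [← h j hj]; exact H j hj, fun H j hj => by rw [h j hj]; exact H j hj⟩
  have hBk : ∀ k, Bk Io b k = Bk Io b' k := fun k => by
    unfold Bk; rw [Finset.sum_congr rfl fun j hj => by rw [h j hj]]
  have hkap : ∀ k, kap Io b k = kap Io b' k := fun k => by
    unfold kap; rw [hBk, Finset.prod_congr rfl fun j hj => by rw [h j hj]]
  have hpp : ∀ t k, plusProd Io t b k = plusProd Io t b' k := fun t k =>
    Finset.prod_congr rfl fun j hj => by rw [h j hj]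
  have hgd : ∀ k, gd Io b k = gd Io b' k := fun k => by
    unfold gd; exact if_congr (hA k) rfl rfl
  have hmc : ∀ j k, mainConst Io c d b j k = mainConst Io c d b' j k := fun j k => by
    unfold mainConst; rw [hgd, hs, hBk, hpp, hkap]
  funext ν
  unfold Fsl mainTerm corr
  rw [hs]
  simp only [hmc, hBk]

end Slice

end R8
end Summit.ValiantsHypothesis.ValiantsHypothesis.Theorems.NewtonUnitEquations.TwoProducts.PermutationType

end
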